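import Mathlib
import Summits.KontsevichZagierPeriods.Zeta5Search.BrickDigitStripMain
import Summits.KontsevichZagierPeriods.Zeta5Search.BrickDigitStripCarry

/-!
# BrickDigitStripCirc — the DIGIT-STRIPPING FACTORISATION for EVERY ° cell:
`F_j(pT) = a·F̃_J(T)·E_j(T)·U_j(T)` with the BOUNDARY POLYNOMIAL
`E_j = (T − y_a)^{B c_a}(T + y_b)^{B c_b}(T + y_c)^{ε c_c}` of the gained members (zi-p2 THEOREM 7 LEMMA 2 (i) (★)
for `c_h = 0`; cell zeta5-irr)

HONEST FRAMING: systematic search; no irrationality claim unless certified. INSTRUMENT lemma of the ζ(5)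
census cell zeta5-irr (HOME `run/shared/lean/pub/zeta5-irr/`; memo `zi-p2/probes/B8/thm7/THEOREM7.md` §2 LEMMA 2 (i)
«(★) EXACTLY in ℚ[[T]]: F_K^{(N)}(pT) = λ_K · F̃_{K′}^{(N′)}(T) · E_K(T) · U_K(T), E_K(T) := (1 − T/y_a)^{Bc_a}
(1 + T/y_b)^{B[δ_b=1]}(1 + T/y_h)^{(A+B)c_h}(1 + T/y_l)^{−B[δ_b=−1]}(1 + T/y_c)^{c_c}» — here for the ° cells `c_h = 0`
(so `δ_b ∈ {0,1}`, no `y_h`, no lost member `y_l`), with the boundary factor kept MONIC: `E_j(T) = (T − y_a)^{Bc_a}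
(T + y_b)^{Bc_b}(T + y_c)^{εc_c}` and the constant `a = λ_j/E_j(0)`; design note HOME `zi-eng/lean-g8/DESIGN-LEMMA2-TYPES.md`
(A1)). Nothing here is about ζ(5); no irrationality content; filing moves no rung. Filed by the engine seat zi-eng (g9);
sequel of `BrickDigitStripMain` (zi-eng g8: the MAIN case `E_j = 1`) and `BrickDigitStripCarry` (the carry families).

## Objects and statements

`p` an odd prime, `n = n₀ + N·p`, `j = j₀ + J·p`, ° CELL: `j₀ ≤ n₀ < p`, `J ≤ N`. Carries `c_a := (n₀+j₀)/p`,
`c_b := (n₀+(n₀−j₀))/p` (each `∈ {0,1}`), `c_c := centreCarry p n j = [p ∣ n − 2j]`; members `y_a = N+J+1`,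
`y_b = 2N−J+1`, `y_c = (n/2 − j)/p`.
* `centreCarry p n j := if p ∣ n − 2j then 1 else 0`; `carryPoly p B ε N n₀ J j₀ := (X − y_a)^{B c_a}·(X + y_b)^{B c_b}·
  (X + y_c)^{ε c_c} ∈ ℚ[X]` — THE BOUNDARY POLYNOMIAL (monic; `= 1` in the main case).
* `centre_factor_circ`: `(pX + (n/2 − j))^ε = C(c)·(X + y_c)^{ε c_c}·V`, `V` unit, `c ≠ 0` (both centre cases at once).
* `num_comp_eq_circ`: `taylor_{−j}(kerNum^{ε}_n)(pX) = C(a)·taylor_{−J}(kerNum^{0}_N)·carryPoly·V`, `V` unit, `a ≠ 0`.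
* **`laurentSeries_rescale_eq_circ`**: `rescale_p(laurentSeries A B ε n j) = C(a)·laurentSeries A B 0 N J·carryPoly·U`,
  `U(0) = 1`, `ScaledSeries.IsSlopeInt p (−1) 0 U`, and **`a·carryPoly(0)·laurent A B 0 N J 0 = laurent A B ε n j 0`**.
* `isSlopeInt_carryPoly`: `carryPoly ∈ ℤ_(p)[X]` coefficientwise (slope `0`, budget `0`); `carryPoly_eval_zero_ne_zero`
  off the exact centre (`2j ≠ n ∨ ε = 0`); `carryPoly_eq_one` when all three carries vanish (`E_j = 1`: main case).
The valuation of `a` (`v_p(a) = B c_a + B c_b + ε c_c`, THEOREM 7 (2.3)) and the ° -cell residue law are the sequel files.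
-/

namespace Summit.KontsevichZagierPeriods.Zeta5Search.BrickDigitStripCirc

open Finset Nat Polynomial WithZero
open Summit.KontsevichZagierPeriods.Zeta5Search.BrickLaurent (expandAt laurentSeries laurent kerNum kerDenErase
  constantCoeff_coe_taylor coe_comp_C_mul_X rescale_inv eval_kerDenErase_neg_ne_zero)
open Summit.KontsevichZagierPeriods.Zeta5Search.BrickLaurentValuation (taylor_kerNum taylor_kerDenErase lin)
open Summit.KontsevichZagierPeriods.Zeta5Search.ScaledSeries (IsSlopeInt isSlopeInt_mul isSlopeInt_pow isSlopeInt_one)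
open Summit.KontsevichZagierPeriods.Zeta5Search.BrickPhiCoeff (isSlopeInt_inv)
open Summit.KontsevichZagierPeriods.Zeta5Search.BrickDigitStrip (IsUnitPoly isUnitPoly_one den_family centre_factor)
open Summit.KontsevichZagierPeriods.Zeta5Search.BrickDigitStripMain (den_comp_eq)
open Summit.KontsevichZagierPeriods.Zeta5Search.BrickDigitStripCarry (num_family_one_carry num_family_two_carry
  prod_Icc_add_of_le_one centre_factor_div padicValuation_centre_le centre_ne_zero div_two_carry_le_one)
open Literature.NumberTheory.LFunctions (padicValuation_natCast_le_one)

noncomputable section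

variable {p : ℕ} [Fact p.Prime]

/-! ## The boundary polynomial of a ° cell -/

/-- The centre-carry indicator `c_c = [p ∣ n − 2j] ∈ {0,1}` (THEOREM 7 §0: `c_c := [p | N−2K, K ≠ N/2]`; the exact
centre `2j = n` is NOT excluded here — there `y_c = 0` and the cell is treated separately downstream). -/
def centreCarry (p n j : ℕ) : ℕ := if (p : ℤ) ∣ (n : ℤ) - 2 * j then 1 else 0

/-- **The boundary polynomial** `E_j = (X − y_a)^{B c_a}·(X + y_b)^{B c_b}·(X + y_c)^{ε c_c} ∈ ℚ[X]` of the ° cell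
`(n, j) = (n₀ + Np, j₀ + Jp)`: gained members `y_a = N+J+1` (carry `c_a = (n₀+j₀)/p`), `y_b = 2N−J+1` (carry
`c_b = (2n₀−j₀)/p`), centre member `y_c = (n/2 − j)/p` (carry `c_c = [p ∣ n−2j]`); monic, `= 1` in the main case. -/
def carryPoly (p B ε N n₀ J j₀ : ℕ) : ℚ[X] :=
  (X + C (-((J : ℚ) + ((N + 1 : ℕ) : ℚ)))) ^ (B * ((n₀ + j₀) / p)) *
    (X + C ((N : ℚ) + ((N + 1 : ℕ) : ℚ) - J)) ^ (B * ((n₀ + (n₀ - j₀)) / p)) *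
    (X + C ((((n₀ + N * p : ℕ) : ℚ) / 2 - ((j₀ + J * p : ℕ) : ℚ)) / p)) ^
      (ε * centreCarry p (n₀ + N * p) (j₀ + J * p))

omit [Fact p.Prime] in
/-- `c_c ≤ 1`. -/
theorem centreCarry_le_one (p n j : ℕ) : centreCarry p n j ≤ 1 := by
  unfold centreCarry; split_ifs <;> omega

omit [Fact p.Prime] in
/-- In the main case (no carry of any kind) the boundary polynomial is `1`. -/
theorem carryPoly_eq_one {B ε N n₀ J j₀ : ℕ} (h1 : n₀ + j₀ < p) (h2 : n₀ + (n₀ - j₀) < p)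
    (hcen : ε = 0 ∨ ¬ (p : ℤ) ∣ ((n₀ + N * p : ℕ) : ℤ) - 2 * (j₀ + J * p : ℕ)) :
    carryPoly p B ε N n₀ J j₀ = 1 := by
  unfold carryPoly
  rw [Nat.div_eq_of_lt h1, Nat.div_eq_of_lt h2, mul_zero, pow_zero, pow_zero, one_mul, one_mul]
  rcases hcen with h | h
  · rw [h, zero_mul, pow_zero]
  · rw [centreCarry, if_neg h, mul_zero, pow_zero]

/-- The boundary polynomial does not vanish at `0` off the exact centre (`2j ≠ n` or `ε = 0`). -/
theorem carryPoly_eval_zero_ne_zero {B ε N n₀ J j₀ : ℕ} (hJN : J ≤ N)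
    (hcen : 2 * (j₀ + J * p) ≠ n₀ + N * p ∨ ε = 0) : (carryPoly p B ε N n₀ J j₀).eval 0 ≠ 0 := by
  unfold carryPoly
  simp only [eval_mul, eval_pow, eval_add, eval_X, eval_C, zero_add]
  refine mul_ne_zero (mul_ne_zero (pow_ne_zero _ ?_) (pow_ne_zero _ ?_)) ?_
  · rw [neg_ne_zero]; positivity
  · have : (J : ℚ) ≤ N := by exact_mod_cast hJN
    push_cast; linarith
  · rcases hcen with h | h
    · exact pow_ne_zero _ (centre_ne_zero (p := p) h)
    · rw [h, zero_mul, pow_zero]; exact one_ne_zero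

/-- A linear factor `X + z` with `z ∈ ℤ_(p)` is `(0,0)`-integral as a power series. -/
theorem isSlopeInt_X_add_C {z : ℚ} (hz : Rat.padicValuation p z ≤ 1) :
    IsSlopeInt p 0 0 ((X + C z : ℚ[X]) : PowerSeries ℚ) := by
  intro k
  rw [zero_mul, zero_add, exp_zero, Polynomial.coeff_coe, coeff_add, coeff_X, coeff_C]
  split_ifs with h1 h2 h2
  · omega
  · rw [add_zero, map_one]
  · rw [zero_add]; exact hz
  · rw [add_zero, map_zero]; exact _root_.zero_le

/-- **`carryPoly ∈ ℤ_(p)[X]`** coefficientwise (odd `p`): `IsSlopeInt p 0 0 carryPoly`. -/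
theorem isSlopeInt_carryPoly (hp2 : p ≠ 2) (B ε N n₀ J j₀ : ℕ) :
    IsSlopeInt p 0 0 ((carryPoly p B ε N n₀ J j₀ : ℚ[X]) : PowerSeries ℚ) := by
  unfold carryPoly
  rw [Polynomial.coe_mul, Polynomial.coe_mul, Polynomial.coe_pow, Polynomial.coe_pow, Polynomial.coe_pow]
  have ha : IsSlopeInt p 0 0 (((X + C (-((J : ℚ) + ((N + 1 : ℕ) : ℚ))) : ℚ[X]) : PowerSeries ℚ)) := by
    refine isSlopeInt_X_add_C ?_
    rw [Valuation.map_neg, ← Nat.cast_add]; exact padicValuation_natCast_le_one _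
  have hb : IsSlopeInt p 0 0 (((X + C ((N : ℚ) + ((N + 1 : ℕ) : ℚ) - J)) : ℚ[X]) : PowerSeries ℚ) := by
    refine isSlopeInt_X_add_C ?_
    rw [show (N : ℚ) + ((N + 1 : ℕ) : ℚ) - J = (((N : ℤ) + (N + 1 : ℕ) - J : ℤ) : ℚ) by push_cast; ring,
      Rat.padicValuation_cast]
    exact Int.padicValuation_le_one _ _
  set Yc : PowerSeries ℚ :=
    (((X + C ((((n₀ + N * p : ℕ) : ℚ) / 2 - ((j₀ + J * p : ℕ) : ℚ)) / p)) : ℚ[X]) : PowerSeries ℚ) with hYc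
  have hc : IsSlopeInt p 0 0 (Yc ^ (ε * centreCarry p (n₀ + N * p) (j₀ + J * p))) := by
    unfold centreCarry
    split_ifs with h
    · exact isSlopeInt_pow (isSlopeInt_X_add_C (padicValuation_centre_le (p := p) hp2 h)) _
    · rw [mul_zero, pow_zero]; exact isSlopeInt_one 0
  have h := isSlopeInt_mul (isSlopeInt_mul (isSlopeInt_pow ha (B * ((n₀ + j₀) / p)))
    (isSlopeInt_pow hb (B * ((n₀ + (n₀ - j₀)) / p)))) hc
  simpa using h

/-! ## The centre factor, both cases at once -/

/-- THE CENTRE FACTOR for every cell: `(pX + (n/2 − j))^ε = C(c)·(X + y_c)^{ε·c_c}·V`, `V` unit, `c ≠ 0` (odd `p`). -/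
theorem centre_factor_circ (hp2 : p ≠ 2) (ε n j : ℕ) :
    ∃ V : ℚ[X], IsUnitPoly p V ∧ ∃ c : ℚ, c ≠ 0 ∧
      (C (p : ℚ) * X + C ((n : ℚ) / 2 - j)) ^ ε = C c * (X + C (((n : ℚ) / 2 - j) / p)) ^ (ε * centreCarry p n j) * V := by
  have hp : p.Prime := Fact.out
  unfold centreCarry
  split_ifs with h
  · refine ⟨1, isUnitPoly_one, (p : ℚ) ^ ε, pow_ne_zero _ (by exact_mod_cast hp.ne_zero), ?_⟩
    rw [centre_factor_div, mul_one, mul_one]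
  · obtain ⟨V, hV, c, hc, hceq⟩ := centre_factor (p := p) hp2 (ε := ε) (n := n) (j := j) (Or.inr h)
    exact ⟨V, hV, c, hc, by rw [hceq, mul_zero, pow_zero, mul_one]⟩

/-! ## The assembled factorisation for ° cells -/

section circ

variable (hp2 : p ≠ 2) {A B ε N n₀ J j₀ : ℕ} (hn₀ : n₀ < p) (hj₀ : j₀ ≤ n₀) (hJN : J ≤ N)
include hp2 hn₀ hj₀ hJN

/-- NUMERATOR of a ° cell: `taylor_{−j}(kerNum^{ε}_n)(pX) = C(a)·taylor_{−J}(kerNum^{0}_N)·carryPoly·V`, `V` unit,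
`a ≠ 0`. -/
theorem num_comp_eq_circ :
    ∃ V : ℚ[X], IsUnitPoly p V ∧ ∃ a : ℚ, a ≠ 0 ∧
      (taylor (-((j₀ + J * p : ℕ) : ℚ)) (kerNum A B ε (n₀ + N * p))).comp (C (p : ℚ) * X) =
        C a * taylor (-(J : ℚ)) (kerNum A B 0 N) * carryPoly p B ε N n₀ J j₀ * V := by
  obtain ⟨Vc, hVc, cc, hcc, hceq⟩ := centre_factor_circ (p := p) hp2 ε (n₀ + N * p) (j₀ + J * p)
  obtain ⟨V₁, hV₁, c₁, hc₁, h₁⟩ := num_family_one_carry (p := p) hn₀ hj₀ N J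
  obtain ⟨V₂, hV₂, c₂, hc₂, h₂⟩ := num_family_two_carry (p := p) hn₀ hj₀ hJN
  have hca : (n₀ + j₀) / p ≤ 1 := div_two_carry_le_one hn₀ (by omega)
  have hcb : (n₀ + (n₀ - j₀)) / p ≤ 1 := div_two_carry_le_one hn₀ (by omega)
  rw [prod_Icc_add_of_le_one _ N hca] at h₁
  rw [prod_Icc_add_of_le_one _ N hcb] at h₂
  set P₁ : ℚ[X] := ∏ t ∈ Icc 1 N, (X + C (-((J : ℚ) + t))) with hP₁
  set P₂ : ℚ[X] := ∏ t ∈ Icc 1 N, (X + C ((N : ℚ) + t - J)) with hP₂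
  set Ya : ℚ[X] := X + C (-((J : ℚ) + ((N + 1 : ℕ) : ℚ))) with hYa
  set Yb : ℚ[X] := X + C ((N : ℚ) + ((N + 1 : ℕ) : ℚ) - J) with hYb
  set Yc : ℚ[X] := X + C (((((n₀ + N * p : ℕ) : ℚ)) / 2 - ((j₀ + J * p : ℕ) : ℚ)) / p) with hYc
  have hNf : ((N ! : ℚ)) ^ (A - 2 * B) ≠ 0 := pow_ne_zero _ (by positivity)
  have hnf : (((n₀ + N * p)! : ℚ)) ^ (A - 2 * B) ≠ 0 := pow_ne_zero _ (by positivity)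
  set a : ℚ := (((n₀ + N * p)! : ℚ)) ^ (A - 2 * B) * cc * c₁ ^ B * c₂ ^ B / ((N ! : ℚ)) ^ (A - 2 * B) with ha
  have key : C ((((n₀ + N * p)! : ℚ)) ^ (A - 2 * B)) * C cc * C c₁ ^ B * C c₂ ^ B = C a * C (((N ! : ℚ)) ^ (A - 2 * B)) := by
    rw [← map_pow, ← map_pow, ← map_mul, ← map_mul, ← map_mul, ← map_mul, ha, div_mul_cancel₀ _ hNf]
  refine ⟨Vc * (V₁ ^ B * V₂ ^ B), hVc.mul ((hV₁.pow B).mul (hV₂.pow B)), a,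
    div_ne_zero (mul_ne_zero (mul_ne_zero (mul_ne_zero hnf hcc) (pow_ne_zero _ hc₁)) (pow_ne_zero _ hc₂)) hNf, ?_⟩
  rw [taylor_kerNum, taylor_kerNum]
  simp only [mul_comp, pow_comp, Polynomial.prod_comp, add_comp, X_comp, C_comp]
  rw [hceq, h₁, h₂, pow_zero, mul_one]
  unfold carryPoly
  rw [← hYa, ← hYb, ← hYc, pow_mul' Ya B ((n₀ + j₀) / p), pow_mul' Yb B ((n₀ + (n₀ - j₀)) / p)]
  linear_combination (Vc * V₁ ^ B * V₂ ^ B * P₁ ^ B * P₂ ^ B * (Ya ^ ((n₀ + j₀) / p)) ^ B *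
    (Yb ^ ((n₀ + (n₀ - j₀)) / p)) ^ B * Yc ^ (ε * centreCarry p (n₀ + N * p) (j₀ + J * p))) * key

/-- **THE DIGIT-STRIPPING FACTORISATION FOR ° CELLS** (★): for `n = n₀ + Np`, `j = j₀ + Jp`, `j₀ ≤ n₀ < p`, `J ≤ N`
(odd `p`): `rescale_p(F_j) = C(a)·F̃_J·E_j·U` with `E_j = carryPoly`, `U(0) = 1`, `[T^g]U ∈ p^gℤ_(p)`, and the
constant terms `a·E_j(0)·c̃_{J,A}(N) = c_{j,A}(n)` (so `a·E_j(0) = λ_j`). -/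
theorem laurentSeries_rescale_eq_circ {n j : ℕ} (hn : n = n₀ + N * p) (hj : j = j₀ + J * p) :
    ∃ U : PowerSeries ℚ, PowerSeries.constantCoeff U = 1 ∧ IsSlopeInt p (-1) 0 U ∧ ∃ a : ℚ,
      PowerSeries.rescale (p : ℚ) (laurentSeries A B ε n j) =
        PowerSeries.C a * laurentSeries A B 0 N J * ((carryPoly p B ε N n₀ J j₀ : ℚ[X]) : PowerSeries ℚ) * U ∧
      a * (carryPoly p B ε N n₀ J j₀).eval 0 * laurent A B 0 N J 0 = laurent A B ε n j 0 := by
  subst hn hj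
  obtain ⟨V₁, hV₁, a, ha, hN⟩ := num_comp_eq_circ (p := p) hp2 hn₀ hj₀ hJN (A := A) (B := B) (ε := ε)
  obtain ⟨V₂, hV₂, b, hb, hD⟩ := den_comp_eq (p := p) hn₀ hj₀ A N J
  have hV₁0 : PowerSeries.constantCoeff (V₁ : PowerSeries ℚ) = 1 := by
    rw [Polynomial.constantCoeff_coe, coeff_zero_eq_eval_zero, hV₁.1]
  have hV₂0 : PowerSeries.constantCoeff (V₂ : PowerSeries ℚ) = 1 := by
    rw [Polynomial.constantCoeff_coe, coeff_zero_eq_eval_zero, hV₂.1]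
  have hU0 : PowerSeries.constantCoeff ((V₁ : PowerSeries ℚ) * (V₂ : PowerSeries ℚ)⁻¹) = 1 := by
    rw [map_mul, PowerSeries.constantCoeff_inv, hV₁0, hV₂0, inv_one, mul_one]
  have hUint : IsSlopeInt p (-1) 0 ((V₁ : PowerSeries ℚ) * (V₂ : PowerSeries ℚ)⁻¹) := by
    have h := isSlopeInt_mul hV₁.2 (isSlopeInt_inv hV₂.2 (by rw [hV₂0, map_one]))
    rwa [add_zero] at h
  set E : ℚ[X] := carryPoly p B ε N n₀ J j₀ with hE
  -- the identity
  have hid : PowerSeries.rescale (p : ℚ) (laurentSeries A B ε (n₀ + N * p) (j₀ + J * p)) =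
      PowerSeries.C (a / b) * laurentSeries A B 0 N J * (E : PowerSeries ℚ) *
        ((V₁ : PowerSeries ℚ) * (V₂ : PowerSeries ℚ)⁻¹) := by
    have hL : PowerSeries.rescale (p : ℚ) (laurentSeries A B ε (n₀ + N * p) (j₀ + J * p)) =
        (((taylor (-((j₀ + J * p : ℕ) : ℚ)) (kerNum A B ε (n₀ + N * p))).comp (C (p : ℚ) * X) : ℚ[X]) :
          PowerSeries ℚ) *
        ((((taylor (-((j₀ + J * p : ℕ) : ℚ)) (kerDenErase A (n₀ + N * p) (j₀ + J * p))).comp (C (p : ℚ) * X) :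
          ℚ[X]) : PowerSeries ℚ))⁻¹ := by
      rw [laurentSeries, expandAt, map_mul, rescale_inv _ (by
        rw [constantCoeff_coe_taylor]; exact eval_kerDenErase_neg_ne_zero _ _ _), coe_comp_C_mul_X, coe_comp_C_mul_X]
    rw [hL, hN, hD, laurentSeries, expandAt]
    simp only [Polynomial.coe_mul, Polynomial.coe_C, PowerSeries.mul_inv_rev, PowerSeries.C_inv]
    rw [div_eq_mul_inv, map_mul]
    ring
  refine ⟨_, hU0, hUint, a / b, hid, ?_⟩
  -- constant terms
  have h0 := congrArg (PowerSeries.coeff 0) hid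
  rw [PowerSeries.coeff_rescale, pow_zero, one_mul, mul_assoc, mul_assoc, PowerSeries.coeff_C_mul,
    PowerSeries.coeff_zero_eq_constantCoeff_apply (laurentSeries A B 0 N J * _), map_mul, map_mul, hU0, mul_one,
    Polynomial.constantCoeff_coe, coeff_zero_eq_eval_zero, ← PowerSeries.coeff_zero_eq_constantCoeff_apply] at h0
  rw [laurent, laurent, h0]
  ring

/-- **Coefficientwise**: `p^d·laurent A B ε n j d = a·Σ_{(e,g), e+g=d} laurent A B 0 N J e·[T^g](E_j·U)`. -/
theorem laurent_rescale_eq_sum_circ {n j : ℕ} (hn : n = n₀ + N * p) (hj : j = j₀ + J * p) :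
    ∃ U : PowerSeries ℚ, PowerSeries.constantCoeff U = 1 ∧ IsSlopeInt p (-1) 0 U ∧ ∃ a : ℚ,
      (∀ d : ℕ, (p : ℚ) ^ d * laurent A B ε n j d =
        a * ∑ x ∈ antidiagonal d, laurent A B 0 N J x.1 *
          PowerSeries.coeff x.2 (((carryPoly p B ε N n₀ J j₀ : ℚ[X]) : PowerSeries ℚ) * U)) ∧
      a * (carryPoly p B ε N n₀ J j₀).eval 0 * laurent A B 0 N J 0 = laurent A B ε n j 0 := by
  obtain ⟨U, hU0, hUint, a, hid, hlam⟩ := laurentSeries_rescale_eq_circ (p := p) hp2 hn₀ hj₀ hJN (A := A) (B := B)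
    (ε := ε) hn hj
  refine ⟨U, hU0, hUint, a, fun d => ?_, hlam⟩
  have h := congrArg (PowerSeries.coeff d) hid
  rw [PowerSeries.coeff_rescale, mul_assoc, mul_assoc, PowerSeries.coeff_C_mul, PowerSeries.coeff_mul] at h
  exact h

end circ

end

end Summit.KontsevichZagierPeriods.Zeta5Search.BrickDigitStripCirc
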